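import Literature.MathematicalPhysics.QuantumFieldTheory.Balaban1983to89.Beta.WilsonVertex2
import Literature.MathematicalPhysics.QuantumFieldTheory.Balaban1983to89.Beta.WilsonWardJets

/-!
# The current annihilates the chart's gauge directions at order `B²`: a Ward identity for the Wilson `(1,2)`- and `(1,1)`-jets, with integer closed forms of the order-`B²` jets

HONEST FRAMING (cell `pub-balaban`, β sub-cell, lineage an3; verbatim): discharging `BetaPertH` makes Bałaban's UV stability
UNCONDITIONAL — a real constructive-QFT result; it is NOT the continuum limit and NOT the Clay problem.  This file discharges NOTHING
of `BetaPertH`.  ABSOLUTE RULE of the cell (verbatim): «No internally-minted statement may enter as a cited fact. Every hypothesis is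
either kernel-proved in this package or a verbatim quotation of a PUBLISHED theorem with page reference. The manuscript(s) under audit
are NOT citable for their own disputed steps — they are the thing under adjudication; programme-internal (2001/route/tribunal) claims
are never citable.»  Accordingly every declaration below is a definition or is kernel-proved here from the imports; NOTHING is cited;
no `def … : Prop` occurs at all.

## What is proved

This is the order-`B²` companion of `Beta.WilsonWardJets` (there: orders `B⁰`, `B¹`; read its header for the setting).  As there,
`F_{n,m}` is the part of `τ(U(∂p))` of degree `n` in the fluctuation letters `W` and `m` in the background letters `B` in the chart
`U_b = e^{W_b}·e^{B_b}` of [Balaban1985BackgroundPropagators] (3.1) p. 390 (`Beta.WilsonVertex.plaq`): `F_{2,2} = τ ∘ P22`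
(`Beta.WilsonVertex2`), `F_{2,1} = τ ∘ P21`, `F_{1,2} = τ ∘ P12`, `F_{1,1} = τ ∘ P11`.  Corners `x₁ → x₂ → x₃ ← x₄ ← x₁`
(`b₁ : x₁ → x₂`, `b₂ : x₂ → x₃`, `b₃ : x₄ → x₃`, `b₄ : x₁ → x₄`), corner letters `λ₁, …, λ₄`.  The GAUGE DIRECTIONS of the chart
through order `B¹` are the graded pieces of `λ(b₋) − Ad_{e^{B_b}} λ(b₊)`: `W₀λ = (λ₁ − λ₂, λ₂ − λ₃, λ₄ − λ₃, λ₁ − λ₄)` and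
`W₁(B)λ = −[B_b, λ(b₊)]` (letters `λ₊B_b − B_bλ₊`).  For EVERY ring `𝔸`, every `𝕜`-linear TRACIAL `τ` and ALL letters:

* `ward12` (ORDER `B²`, FIRST ORDER IN `W`, per plaquette): `2·F_{1,2}(W₀λ) + 2·F_{1,1}(W₁(B)λ) = 0`, and `ward12'` (the factor `2`
  cancelled) — the CURRENT (the `W`-linear jet of the plaquette action) annihilates the chart's gauge directions also at order `B²`.
  New at this order: only the SUM vanishes — the transport of `λ(b₊)` by `B_b` (`W₁`) is needed to close the telescoping sum around
  the plaquette (one order down, `WilsonWardJets.ward11` and `ward10` vanish separately);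
* `ward12_plaqWord`, `jet12_ward` (LATTICE-SUMMED): with the summed `(1,2)`-jet `jet12` defined here (next to `WilsonWardJets.jet11`)
  and the fields `WilsonWardJets.gaugeDir₀ e λ`, `gaugeDir₁ e B λ`: `2·jet12(W₀λ; B) + 2·jet11(W₁(B)λ; B) = 0` for every `B`, `λ`.

INTEGER CLOSED FORMS OF THE ORDER-`B²` JETS (§1, the `½`'s cleared; proved for later certificate work at this order, used here for
`P12`): `two_smul_ad₂` (`2·ad₂ β c x = [β,[β,x]] + [c,x]`), `two_smul_twist₂_plaq` (twice `WilsonVertex2.twist₂_plaq`, explicit),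
`four_smul_trace_P22` (from `WilsonVertex2.trace_P22`: `4τP22 = τ(Z_W·T₂' + Z_W·T₂') + τ(T₁² + T₁²) + τ(Q'·Z_B + Q'·Z_B) + τ(q_W'·q_B')`,
`T₂' = 2·twist₂`, `T₁ = twist`, `Q' = 2·qtwist`, `q' = 2·quad`), `four_smul_trace_P21` (twice `WilsonVertex.two_smul_trace_P21`),
`two_smul_trace_P12` (from the ring identity `WilsonVertex2.P12_eq_transport`), `two_smul_trace_P11` (`WilsonVertex.P11_eq`).
`ward12` is then ONE ring identity `inside = Σ_a [a, P_a]` over the eight letters `B, λ` (`WilsonWardJets.csum`, an 18-monomial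
certificate grouped by the left letter), checked by `noncomm_ring`, and `τ` kills the commutators
(`WilsonWardJets.trace_eq_zero_of_eq_csum`).  No Baker–Campbell–Hausdorff series, no analysis, no cited fact; the certificate was
generated by the archived exact engine `records/ward2/cert2_gen.py` / `cert2_all.py` and the kernel re-verifies the ring identity.

## Why (dictionary to `Beta.LagrangianGaugeDegeneracy`, continued from `Beta.WilsonWardJets`)

In the dictionary `s₁ ↔ F_{1,•}` (the current), `w ↔ W₀λ + W₁(B)λ + ⋯` (gauge directions of the chart) the statement «`s₁` vanishes
on gauge directions», graded by `B`-degree `n`, reads `Σ_{j+k=n} F_{1,j}(W_kλ) = 0`; degrees `0`, `1` are `WilsonWardJets.ward10`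
(with `trace_wsum_plaq_comm`) and `ward11`; degree `2` is `ward12` here (`F_{1,0}(W₂λ) = 0` drops by `trace_wsum_plaq_comm`, `W₂λ`
being a commutator bondwise).  PROVENANCE (not used in proofs): invariance of `τ(U(∂p))` under `U_b ↦ u(x_{b₋}) U_b u(x_{b₊})⁻¹`,
`u = e^{λ}`, at `W = 0`, second order in `B`.

## What this file does NOT do

It does NOT prove the order-`B²` identity that is SECOND order in `W` (the `(2,2)`-jet against the currents,
`4·Pol F_{2,2}(h, W₀λ) + 4·Pol F_{2,1}(h, W₁(B)λ) + 2·Pol F_{2,0}(h, 2W₂(B)λ) = 2·F_{1,2}(N₀(h)λ) + 2·F_{1,1}(N₁(h)λ)`): that identity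
is verified ONLY by the archived exact engine (difference of 933 monomials in twelve letters, cyclically zero, 671-monomial
certificate) and its one-shot kernel certification exceeds the normaliser's budget (`noncomm_ring` at 4·10⁶ heartbeats); it is NOT
claimed here and awaits a structured proof.  Nothing at order `B³` or higher; nothing about the minimiser manifold, the hypotheses
(K2), (L) of `Beta.LagrangianGaugeDegeneracy`, (c1)–(c3) of `Beta.GaugeFixing`, or any estimate; it moves no wall statement; it is
not summit progress, not the continuum limit, not Clay.  [folklore] throughout: multilinear algebra in an arbitrary normed algebra.
-/

namespace Literature.MathematicalPhysics.QuantumFieldTheory.Balaban1983to89.Beta.WilsonWardJets2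

open Finset
open scoped BigOperators
open Literature.MathematicalPhysics.QuantumFieldTheory.Balaban1983to89.Beta.TransportVertices
open Literature.MathematicalPhysics.QuantumFieldTheory.Balaban1983to89.Beta.WilsonVertex
open Literature.MathematicalPhysics.QuantumFieldTheory.Balaban1983to89.Beta.WilsonVertex2
open Literature.MathematicalPhysics.QuantumFieldTheory.Balaban1983to89.Beta.SpinTable (br)
open Literature.MathematicalPhysics.QuantumFieldTheory.Balaban1983to89.Beta.PlaquetteVertex (plaqWord)
open Literature.MathematicalPhysics.QuantumFieldTheory.Balaban1983to89.Beta.WilsonWardJets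
  (csum csum_nil csum_cons trace_eq_zero_of_eq_csum gaugeDir₀ gaugeDir₁ jet11)

/-! ## §1 Integer closed forms of the jets (the `½`'s of `P22`, `P21`, `P12`, `quad`, `ad₂` cleared) -/

section ClosedForms

variable (𝕜 : Type*) [RCLike 𝕜] {𝔸 : Type*} [NormedRing 𝔸] [NormedAlgebra 𝕜 𝔸]
variable {V : Type*} [AddCommGroup V] [Module 𝕜 V]

/-- `2·ad₂ β c x = [β,[β,x]] + [c,x]` — the second-order adjoint transport with its `½`'s cleared. [folklore] -/
theorem two_smul_ad₂ (β c x : 𝔸) : (2 : 𝕜) • ad₂ 𝕜 β c x = br β (br β x) + br c x := by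
  rw [ad₂, smul_add, smul_smul, smul_smul, mul_inv_cancel₀ (two_ne_zero' 𝕜), one_smul, one_smul]

/-- TWICE THE SECOND-ORDER TRANSPORT SUM OF THE PLAQUETTE WORD, explicitly (`WilsonVertex2.twist₂_plaq` with `two_smul_ad₂`):
signed letters `(W₂, −W₃, −W₄)` transported by the prefixes `(B₁, 0)`, `(B₁+B₂−B₃, [B₁,B₂]−[B₁+B₂,B₃])`,
`(B₁+B₂−B₃−B₄, [B₁,B₂]−[B₁+B₂,B₃]−[B₁+B₂−B₃,B₄])`. [folklore] -/
theorem two_smul_twist₂_plaq (W₁ W₂ W₃ W₄ B₁ B₂ B₃ B₄ : 𝔸) :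
    (2 : 𝕜) • twist₂Aux 𝕜 0 0 (plaq W₁ W₂ W₃ W₄ B₁ B₂ B₃ B₄) =
      (br B₁ (br B₁ W₂) + br 0 W₂)
        - (br (B₁ + B₂ - B₃) (br (B₁ + B₂ - B₃) W₃) + br (br B₁ B₂ - br (B₁ + B₂) B₃) W₃)
        - (br (B₁ + B₂ - B₃ - B₄) (br (B₁ + B₂ - B₃ - B₄) W₄)
            + br (br B₁ B₂ - br (B₁ + B₂) B₃ - br (B₁ + B₂ - B₃) B₄) W₄) := by
  rw [twist₂_plaq, smul_sub, smul_sub, two_smul_ad₂, two_smul_ad₂, two_smul_ad₂]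

/-- **`4·τ(P22 L)` IN INTEGER CLOSED FORM** (from `WilsonVertex2.trace_P22`): `4τ(P22) = τ(Z_W·T₂' + Z_W·T₂') + τ(T₁² + T₁²)
+ τ(Q'·Z_B + Q'·Z_B) + τ(q_W'·q_B')` with `T₂' = 2·twist₂`, `T₁ = twist`, `Q' = 2·qtwist`, `q' = 2·quad` (each of which has an
integer expansion: `two_smul_twist₂_plaq`, `WilsonVertex2.two_smul_qtwistAux`, `TransportVertices.two_smul_quad`). [folklore] -/
theorem four_smul_trace_P22 (τ : 𝔸 →ₗ[𝕜] V) (hτ : ∀ a b : 𝔸, τ (a * b) = τ (b * a)) (L : List (Bool × 𝔸)) :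
    (4 : 𝕜) • τ (P22 𝕜 L) =
      τ ((wpart L).sum * ((2 : 𝕜) • twist₂Aux 𝕜 0 0 L) + (wpart L).sum * ((2 : 𝕜) • twist₂Aux 𝕜 0 0 L))
        + τ (twistAux 0 L * twistAux 0 L + twistAux 0 L * twistAux 0 L)
        + τ ((2 : 𝕜) • qtwistAux 𝕜 0 L * (bpart L).sum + (2 : 𝕜) • qtwistAux 𝕜 0 L * (bpart L).sum)
        + τ ((2 : 𝕜) • quad 𝕜 (wpart L) * ((2 : 𝕜) • quad 𝕜 (bpart L))) := by
  rw [trace_P22 𝕜 τ hτ L]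
  simp only [map_add, map_smul, smul_mul_assoc, mul_smul_comm, smul_add, smul_smul]
  module

/-- **`4·τ(P21 L)` IN INTEGER CLOSED FORM** (twice `WilsonVertex.two_smul_trace_P21`):
`4τ(P21) = 2τ(Z_W²·Z_B) + 2τ(Z_B·commSum) + 4τ(Z_W·twist)`, written as sums inside `τ`. [folklore] -/
theorem four_smul_trace_P21 (τ : 𝔸 →ₗ[𝕜] V) (hτ : ∀ a b : 𝔸, τ (a * b) = τ (b * a)) (L : List (Bool × 𝔸)) :
    (4 : 𝕜) • τ (P21 𝕜 L) =
      τ ((wpart L).sum * ((wpart L).sum * (bpart L).sum) + (wpart L).sum * ((wpart L).sum * (bpart L).sum))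
        + τ ((bpart L).sum * commSum (wpart L) + (bpart L).sum * commSum (wpart L))
        + τ ((wpart L).sum * twistAux 0 L + (wpart L).sum * twistAux 0 L
            + ((wpart L).sum * twistAux 0 L + (wpart L).sum * twistAux 0 L)) := by
  rw [show (4 : 𝕜) = 2 * 2 by norm_num, mul_smul, two_smul_trace_P21 𝕜 τ hτ L]
  simp only [smul_add, map_add, smul_smul]
  module

/-- **`2·τ(P12 L)` IN INTEGER CLOSED FORM** (from the ring identity `WilsonVertex2.P12_eq_transport`):
`2τ(P12) = τ(2·twist₂) + τ(twist·Z_B + twist·Z_B) + τ(Z_W·(2·quad_B))`. [folklore] -/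
theorem two_smul_trace_P12 (τ : 𝔸 →ₗ[𝕜] V) (L : List (Bool × 𝔸)) :
    (2 : 𝕜) • τ (P12 𝕜 L) =
      τ ((2 : 𝕜) • twist₂Aux 𝕜 0 0 L) + τ (twistAux 0 L * (bpart L).sum + twistAux 0 L * (bpart L).sum)
        + τ ((wpart L).sum * ((2 : 𝕜) • quad 𝕜 (bpart L))) := by
  rw [P12_eq_transport]
  simp only [map_add, map_smul, mul_smul_comm, smul_add]
  module

/-- `2·τ(P11 L) = τ((Z_W·Z_B + twist) + (Z_W·Z_B + twist))` (`WilsonVertex.P11_eq`). [folklore] -/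
theorem two_smul_trace_P11 (τ : 𝔸 →ₗ[𝕜] V) (L : List (Bool × 𝔸)) :
    (2 : 𝕜) • τ (P11 L) =
      τ (((wpart L).sum * (bpart L).sum + twistAux 0 L) + ((wpart L).sum * (bpart L).sum + twistAux 0 L)) := by
  rw [P11_eq, two_smul, ← map_add]

end ClosedForms

/-! ## §2 First order in `W` at order `B²`: the current annihilates the gauge directions, jointly -/

section FirstOrder

variable (𝕜 : Type*) [RCLike 𝕜] {𝔸 : Type*} [NormedRing 𝔸] [NormedAlgebra 𝕜 𝔸]
variable {V : Type*} [AddCommGroup V] [Module 𝕜 V]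
variable (τ : 𝔸 →ₗ[𝕜] V) (B₁ B₂ B₃ B₄ l₁ l₂ l₃ l₄ : 𝔸)

set_option maxHeartbeats 400000 in
/-- **`ward12`: `F_{1,2}(W₀λ) + F_{1,1}(W₁(B)λ) = 0`** (stated `×2`), for every tracial `τ`, all letters: the order-`B²` piece of
«the current annihilates the chart's gauge directions».  Neither term vanishes alone (the transport of `λ(b₊)` by `B_b` is needed to
close the telescoping sum around the plaquette at this order); 18-monomial certificate. [folklore] -/
theorem ward12 (hτ : ∀ a b : 𝔸, τ (a * b) = τ (b * a)) :
    (2 : 𝕜) • τ (P12 𝕜 (plaq (l₁ - l₂) (l₂ - l₃) (l₄ - l₃) (l₁ - l₄) B₁ B₂ B₃ B₄))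
      + (2 : 𝕜) • τ (P11 (plaq (l₂ * B₁ - B₁ * l₂) (l₃ * B₂ - B₂ * l₃) (l₃ * B₃ - B₃ * l₃) (l₄ * B₄ - B₄ * l₄)
          B₁ B₂ B₃ B₄)) = 0 := by
  have z2 : l₁ - l₂ + (l₂ - l₃) - (l₄ - l₃) - (l₁ - l₄) = 0 := by abel
  simp only [two_smul_trace_P12 𝕜 τ, two_smul_trace_P11 𝕜 τ, two_smul_twist₂_plaq, wpart_plaq, bpart_plaq, twist_plaq,
    sum_four_signed, two_smul_quad, commSum_four]
  simp only [z2, zero_mul, map_zero, add_zero]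
  simp only [← map_add]
  refine trace_eq_zero_of_eq_csum 𝕜 τ hτ
    [(B₁,
      2 * (B₁ * l₂)),
    (B₂,
      2 * (B₂ * l₃)),
    (B₃,
      -(2 * (B₃ * l₃))),
    (B₄,
      -(2 * (B₄ * l₄))),
    (l₁,
      B₁ * B₁ + 2 * (B₁ * B₂) + B₂ * B₂ + B₃ * B₃ + 2 * (B₃ * B₄) + B₄ * B₄ - 2 * (B₁ * B₃) - 2 * (B₁ * B₄) - 2 * (B₂ * B₃) - 2 * (B₂ * B₄)),
    (l₂,
      B₁ * B₁),
    (l₃,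
      B₂ * B₂ - B₃ * B₃),
    (l₄,
      -(B₄ * B₄))] ?_
  simp only [csum_cons, csum_nil, br]
  noncomm_ring

/-- `ward12` with the factor `2` cancelled: `τ(P12(plaq W₀λ; B)) + τ(P11(plaq W₁(B)λ; B)) = 0`. [folklore] -/
theorem ward12' (hτ : ∀ a b : 𝔸, τ (a * b) = τ (b * a)) :
    τ (P12 𝕜 (plaq (l₁ - l₂) (l₂ - l₃) (l₄ - l₃) (l₁ - l₄) B₁ B₂ B₃ B₄))
      + τ (P11 (plaq (l₂ * B₁ - B₁ * l₂) (l₃ * B₂ - B₂ * l₃) (l₃ * B₃ - B₃ * l₃) (l₄ * B₄ - B₄ * l₄) B₁ B₂ B₃ B₄)) = 0 := by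
  have h := ward12 𝕜 τ B₁ B₂ B₃ B₄ l₁ l₂ l₃ l₄ hτ
  rw [← smul_add] at h
  exact (smul_eq_zero_iff_right (two_ne_zero' 𝕜)).mp h

end FirstOrder

/-! ## §3 The lattice-summed form: the summed `(1,2)`-jet and `ward12` for `jet12`, `jet11` -/

section Lattice

variable (𝕜 : Type*) [RCLike 𝕜] {𝔸 : Type*} [NormedRing 𝔸] [NormedAlgebra 𝕜 𝔸]
variable {V : Type*} [AddCommGroup V] [Module 𝕜 V]
variable {Λ : Type*} [Fintype Λ] [AddCommGroup Λ] {D : Type*} [Fintype D]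

/-- **THE SUMMED `(1,2)`-JET** of the oriented-plaquette sum: `Σ_x Σ_μ Σ_ν τ(P12(p_{μν}(x)))` — the part of the CURRENT (the
`W`-linear jet) of `B`-degree two, next to `WilsonWardJets.jet11` (degree one) and `PlaquetteVertex.jet21/jet20`,
`PlaquetteVertex2.jet22` on the Hessian side.  A definition asserting nothing. [folklore] -/
def jet12 (τ : 𝔸 →ₗ[𝕜] V) (e : D → Λ) (W B : Λ → D → 𝔸) : V :=
  ∑ x, ∑ μ, ∑ ν, τ (P12 𝕜 (plaqWord e W B x μ ν))

omit [Fintype Λ] [Fintype D] in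
/-- `ward12` for one plaquette word of the lattice: the fields `WilsonWardJets.gaugeDir₀ e λ` and `gaugeDir₁ e B λ` read on the
boundary of `p_{μν}(x)` ARE the letters `W₀λ`, `W₁(B)λ` of `ward12` (far corner `x + e_ν + e_μ = x + e_μ + e_ν`). [folklore] -/
theorem ward12_plaqWord (τ : 𝔸 →ₗ[𝕜] V) (hτ : ∀ a b : 𝔸, τ (a * b) = τ (b * a)) (e : D → Λ) (B : Λ → D → 𝔸) (lam : Λ → 𝔸)
    (x : Λ) (μ ν : D) :
    (2 : 𝕜) • τ (P12 𝕜 (plaqWord e (gaugeDir₀ e lam) B x μ ν))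
      + (2 : 𝕜) • τ (P11 (plaqWord e (gaugeDir₁ e B lam) B x μ ν)) = 0 := by
  simp only [plaqWord, gaugeDir₀, gaugeDir₁]
  rw [add_right_comm x (e ν) (e μ)]
  exact ward12 𝕜 τ (B x μ) (B (x + e μ) ν) (B (x + e ν) μ) (B x ν) (lam x) (lam (x + e μ)) (lam (x + e μ + e ν))
    (lam (x + e ν)) hτ

/-- **`jet12_ward` — THE CURRENT ANNIHILATES THE GAUGE DIRECTIONS AT ORDER `B²`, summed over the lattice:**
`2·jet12(W₀λ; B) + 2·jet11(W₁(B)λ; B) = 0` for every background `B`, every site field `λ`, every tracial `τ`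
(with `WilsonWardJets.jet11_gaugeDir₀` one order down: `jet11(W₀λ; B) = 0`, and `Σ± W₁λ`, `Σ± W₂λ` traceless). [folklore] -/
theorem jet12_ward (τ : 𝔸 →ₗ[𝕜] V) (hτ : ∀ a b : 𝔸, τ (a * b) = τ (b * a)) (e : D → Λ) (B : Λ → D → 𝔸) (lam : Λ → 𝔸) :
    (2 : 𝕜) • jet12 𝕜 τ e (gaugeDir₀ e lam) B + (2 : 𝕜) • jet11 𝕜 τ e (gaugeDir₁ e B lam) B = 0 := by
  simp only [jet12, jet11, Finset.smul_sum, ← Finset.sum_add_distrib]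
  exact Finset.sum_eq_zero fun x _ => Finset.sum_eq_zero fun μ _ => Finset.sum_eq_zero fun ν _ =>
    ward12_plaqWord 𝕜 τ hτ e B lam x μ ν

end Lattice

end Literature.MathematicalPhysics.QuantumFieldTheory.Balaban1983to89.Beta.WilsonWardJets2
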